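import Mathlib
import Summits.MatrixMultiplication.MatrixMultiplication.Theorems.SnSubsetDichotomyHyperoctahedralSubsetsPairwisePacking

/-!
# `SnSubsetDichotomy.HyperoctahedralSubsets`, line `spherical-rank-sieve` — stub `stub_hostSquare`

Host size bound in `Finset` form (crux `stmt-MatrixMultiplication-8305`, registered stub
`stub_hostSquare` of the lead's skeleton for line `spherical-rank-sieve`).

For a fixed-point-free involution `μ` of `Fin n` (`n > 0`) the host
`C(μ) = {σ ∈ S_n : σ μ = μ σ}` satisfies `|C(μ)|² ≤ n · n!`: `μ` has cycle type `2^m` with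
`n = 2m`, so `|C(μ)| = 2^m · m!` and `(2^m · m!)² = 4^m (m!)² ≤ 2m · binom(2m, m) · (m!)² = n · n!`.
The subgroup form `natCard_centralizer_sq_le` is in the sibling file
`SnSubsetDichotomyHyperoctahedralSubsetsPairwisePacking`; here we only convert
`(univ.filter (σ * μ = μ * σ)).card` to `Nat.card ↥(Subgroup.centralizer {μ})`
(`Subgroup.mem_centralizer_singleton_iff`).
-/

namespace Summit.MatrixMultiplication.MatrixMultiplication.Theorems.HyperoctahedralSubsets

namespace HostSquare

/-- The `Finset` of permutations commuting with `μ` has the cardinality of the centraliser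
subgroup `Subgroup.centralizer {μ}`. [folklore] -/
theorem card_filter_commute_eq_natCard_centralizer {P : Type*} [Group P] [Fintype P]
    [DecidableEq P] (μ : P) :
    (Finset.univ.filter (fun σ : P => σ * μ = μ * σ)).card =
      Nat.card ↥(Subgroup.centralizer ({μ} : Set P)) := by
  refine (Nat.subtype_card _ fun σ => ?_).symm
  simp only [Finset.mem_filter, Finset.mem_univ, true_and, Subgroup.mem_centralizer_singleton_iff]

end HostSquare

open HostSquare in
/-- **Stub `stub_hostSquare` — host size bound** (line `spherical-rank-sieve` of crux
`SnSubsetDichotomy.HyperoctahedralSubsets`, stmt-MatrixMultiplication-8305).  For a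
fixed-point-free involution `μ` of `Fin n` (`n > 0`), `|{σ : σ μ = μ σ}|² ≤ n · n!`
(`natCard_centralizer_sq_le` of the sibling file, transported to the `Finset` host by
`card_filter_commute_eq_natCard_centralizer`). [folklore] -/
theorem stub_hostSquare : ∀ (n : ℕ), 0 < n → ∀ μ : Equiv.Perm (Fin n), μ * μ = 1 → (∀ v, μ v ≠ v) → (Finset.univ.filter (fun σ : Equiv.Perm (Fin n) => σ * μ = μ * σ)).card ^ 2 ≤ n * n.factorial := by
  intro n hn μ h1 h2
  rw [card_filter_commute_eq_natCard_centralizer μ]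
  exact PairwisePacking.natCard_centralizer_sq_le hn h1 h2

end Summit.MatrixMultiplication.MatrixMultiplication.Theorems.HyperoctahedralSubsets
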